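import Mathlib
import Summits.ResolutionOfSingularities.ResolutionOfSingularities.Theorems.WildQuotientsWildQuotientResolutionPthConeFanDefs

/-!
# The toric fan ideal `𝔞_{a,b}`: exponents of the named generators, exhaustion of the index type
(crux stmt-ResolutionOfSingularities-15640 `WildQuotients.WildQuotientResolution`, line `Sketch`;
chain w45c POST-V5 S2 brick F6 `…ConductorOneToricFan` (res-L1-w45c-lead-1 `S2-DESIGN.md` §3 / §7 (7.6));
companion of `…PthConeFanDefs` (kept under the 400-line cap). [OURS · L1 W4.5c] — NOT a statement of any
manuscript; replaces the role of no printed item. Owner res-L1-w45c-stub-4 (gen 5).)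

* `PthCone.fanExp_v0 … fanExp_eb` — the exponent of each named generator (by `rfl`);
* `PthCone.FIdx.exists_eq` — every index is one of the twelve named constructors.
-/

set_option linter.dupNamespace false

noncomputable section

open MvPolynomial

namespace Summit.ResolutionOfSingularities.ResolutionOfSingularities.Theorems.WildQuotientResolution.PthCone

variable {n p : ℕ} {A : Finset (Fin n)}

/-- [OURS · L1 W4.5c] -/
theorem fanExp_v0 (ρ : A) : fanExp n p A (FIdx.v0 ρ) = Finsupp.single (ρ : Fin n) (p * (p - 1)) := rfl
/-- [OURS · L1 W4.5c] -/
theorem fanExp_q0 (ρ : A) : fanExp n p A (FIdx.q0 ρ) = Finsupp.single (ρ : Fin n) (p ^ 2) := rfl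
/-- [OURS · L1 W4.5c] -/
theorem fanExp_e0 (ρ l : A) : fanExp n p A (FIdx.e0 ρ l) =
    Finsupp.single (ρ : Fin n) (p * (p - 1) - 1) + Finsupp.single (l : Fin n) 1 := rfl
/-- [OURS · L1 W4.5c] -/
theorem fanExp_x0 (ρ : A) (l' : (Aᶜ : Finset (Fin n))) : fanExp n p A (FIdx.x0 ρ l') =
    Finsupp.single (ρ : Fin n) ((p - 1) ^ 2) + Finsupp.single (l' : Fin n) 1 := rfl
/-- [OURS · L1 W4.5c] -/
theorem fanExp_vp (ρ' : (Aᶜ : Finset (Fin n))) :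
    fanExp n p A (FIdx.vp ρ') = Finsupp.single (ρ' : Fin n) (p * (p - 1)) := rfl
/-- [OURS · L1 W4.5c] -/
theorem fanExp_qp (ρ' : (Aᶜ : Finset (Fin n))) :
    fanExp n p A (FIdx.qp ρ') = Finsupp.single (ρ' : Fin n) (p ^ 2) := rfl
/-- [OURS · L1 W4.5c] -/
theorem fanExp_ep (ρ' l' : (Aᶜ : Finset (Fin n))) : fanExp n p A (FIdx.ep ρ' l') =
    Finsupp.single (ρ' : Fin n) (p * (p - 1) - 1) + Finsupp.single (l' : Fin n) 1 := rfl
/-- [OURS · L1 W4.5c] -/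
theorem fanExp_xp (ρ' : (Aᶜ : Finset (Fin n))) (l : A) : fanExp n p A (FIdx.xp ρ' l) =
    Finsupp.single (ρ' : Fin n) ((p - 1) ^ 2) + Finsupp.single (l : Fin n) 1 := rfl
/-- [OURS · L1 W4.5c] -/
theorem fanExp_vm (j : Fin (p - 2)) (ρ : A) (ρ' : (Aᶜ : Finset (Fin n))) :
    fanExp n p A (FIdx.vm j ρ ρ') = vtxExp n p ((j : ℕ) + 1) ρ ρ' := rfl
/-- [OURS · L1 W4.5c] -/
theorem fanExp_qm (i : Fin (p - 1)) (ρ : A) (ρ' : (Aᶜ : Finset (Fin n))) :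
    fanExp n p A (FIdx.qm i ρ ρ') = qExp n p ((i : ℕ) + 1) ρ ρ' := rfl
/-- [OURS · L1 W4.5c] -/
theorem fanExp_ea (j : Fin (p - 2)) (ρ : A) (ρ' : (Aᶜ : Finset (Fin n))) (l : A) :
    fanExp n p A (FIdx.ea j ρ ρ' l) =
      Finsupp.single (ρ : Fin n) ((p - ((j : ℕ) + 1)) * (p - ((j : ℕ) + 1) - 1) - 1) +
        Finsupp.single (ρ' : Fin n) (((j : ℕ) + 1) * ((j : ℕ) + 2)) + Finsupp.single (l : Fin n) 1 := rfl
/-- [OURS · L1 W4.5c] -/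
theorem fanExp_eb (j : Fin (p - 2)) (ρ : A) (ρ' l' : (Aᶜ : Finset (Fin n))) :
    fanExp n p A (FIdx.eb j ρ ρ' l') =
      Finsupp.single (ρ : Fin n) ((p - ((j : ℕ) + 1)) * (p - ((j : ℕ) + 1) - 1)) +
        Finsupp.single (ρ' : Fin n) (((j : ℕ) + 1) * ((j : ℕ) + 2) - 1) + Finsupp.single (l' : Fin n) 1 :=
  rfl

/-- **Exhaustion**: every index is one of the twelve named constructors. [OURS · L1 W4.5c] -/
theorem FIdx.exists_eq (κ : FIdx n p A) :
    (∃ ρ, κ = FIdx.v0 ρ) ∨ (∃ ρ, κ = FIdx.q0 ρ) ∨ (∃ ρ l, κ = FIdx.e0 ρ l) ∨ (∃ ρ l', κ = FIdx.x0 ρ l') ∨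
    (∃ ρ', κ = FIdx.vp ρ') ∨ (∃ ρ', κ = FIdx.qp ρ') ∨ (∃ ρ' l', κ = FIdx.ep ρ' l') ∨
    (∃ ρ' l, κ = FIdx.xp ρ' l) ∨ (∃ j ρ ρ', κ = FIdx.vm j ρ ρ') ∨ (∃ i ρ ρ', κ = FIdx.qm i ρ ρ') ∨
    (∃ j ρ ρ' l, κ = FIdx.ea j ρ ρ' l) ∨ (∃ j ρ ρ' l', κ = FIdx.eb j ρ ρ' l') := by
  rcases κ with (((ρ | ρ) | (⟨ρ, l⟩ | ⟨ρ, l'⟩)) | ((ρ' | ρ') | (⟨ρ', l'⟩ | ⟨ρ', l⟩))) |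
    ((⟨j, ρ, ρ'⟩ | ⟨i, ρ, ρ'⟩) | (⟨j, ρ, ρ', l⟩ | ⟨j, ρ, ρ', l'⟩))
  · exact Or.inl ⟨ρ, rfl⟩
  · exact Or.inr (Or.inl ⟨ρ, rfl⟩)
  · exact Or.inr (Or.inr (Or.inl ⟨ρ, l, rfl⟩))
  · exact Or.inr (Or.inr (Or.inr (Or.inl ⟨ρ, l', rfl⟩)))
  · exact Or.inr (Or.inr (Or.inr (Or.inr (Or.inl ⟨ρ', rfl⟩))))
  · exact Or.inr (Or.inr (Or.inr (Or.inr (Or.inr (Or.inl ⟨ρ', rfl⟩)))))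
  · exact Or.inr (Or.inr (Or.inr (Or.inr (Or.inr (Or.inr (Or.inl ⟨ρ', l', rfl⟩))))))
  · exact Or.inr (Or.inr (Or.inr (Or.inr (Or.inr (Or.inr (Or.inr (Or.inl ⟨ρ', l, rfl⟩)))))))
  · exact Or.inr (Or.inr (Or.inr (Or.inr (Or.inr (Or.inr (Or.inr (Or.inr (Or.inl ⟨j, ρ, ρ', rfl⟩))))))))
  · exact Or.inr (Or.inr (Or.inr (Or.inr (Or.inr (Or.inr (Or.inr (Or.inr (Or.inr
      (Or.inl ⟨i, ρ, ρ', rfl⟩)))))))))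
  · exact Or.inr (Or.inr (Or.inr (Or.inr (Or.inr (Or.inr (Or.inr (Or.inr (Or.inr (Or.inr
      (Or.inl ⟨j, ρ, ρ', l, rfl⟩))))))))))
  · exact Or.inr (Or.inr (Or.inr (Or.inr (Or.inr (Or.inr (Or.inr (Or.inr (Or.inr (Or.inr
      (Or.inr ⟨j, ρ, ρ', l', rfl⟩))))))))))



end Summit.ResolutionOfSingularities.ResolutionOfSingularities.Theorems.WildQuotientResolution.PthCone

end
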